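import Literature.Analysis.Convex.SProcedureStrongAlternatives
import HarnessLib

/-!
# Psd rank two and convex programming: the S-lemma step of the sandwiched-ellipse SDP
# (Fawzi–Gouveia–Parrilo–Robinson–Thomas 2015, §4)

Source: H. Fawzi, J. Gouveia, P. Parrilo, R. Robinson, R. Thomas, *Positive semidefinite rank*,
Math. Program. 153 (2015) = arXiv:1407.4095 [FawziEtAl2015], §4 "Psd rank two and convex programming",
held text `paper:arxiv-1407.4095` chunk p13. Companion of `NestedRectanglesPsdRank.lean`
(`FawziEtAl2015_sec4_ellipse_holds`: for `rank M = 3`, `rank_psd M = 2` iff an ellipse is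
sandwiched between the inner and outer polygons [gouveia2013worst]) and of the tree's S-procedure
files `Literature/Analysis/Convex/SProcedure*.lean` (Boyd–Vandenberghe App. B, whose vocabulary
`quadPQR A b c x = xᵀAx + 2bᵀx + c`, `quadBlock A b c = [A b; bᵀ c]` is reused by name).
Everything below is PROVED; no named facts.

## The printed text (p13, verbatim) and what is typed

"One can show that there exists an ellipse sandwiched between `P` and `Q` if, and only if, there
exist `A ∈ S², b ∈ ℝ²` and `c ∈ ℝ` such that: 1. `A ⪰ 0`, `trace(A) = 1`; 2.
`[x_j; 1]ᵀ [A b; bᵀ c] [x_j; 1] ≤ 0 ∀ j = 1,…,v`; 3. `∃ λ_i ≥ 0 : [A b; bᵀ c] ⪰ λ_i [0 g_iᵀ/2;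
g_i/2 −h_i] ∀ i = 1,…,f`. The ellipse … is `E = {x ∈ ℝ² : [x;1]ᵀ [A b; bᵀ c] [x;1] ≤ 0}`. Note that
the constraint (2) above corresponds to the condition `P ⊆ E` and the constraint (3) corresponds to
`E ⊆ Q`. The latter uses the following result commonly known as the S-lemma [boyd2004convex]:
**Lemma 4.2.** Let `A_i ∈ Sⁿ, b_i ∈ ℝⁿ, c_i ∈ ℝ` for `i = 1,2` and assume that the following
implication holds for all `x ∈ ℝⁿ`: `xᵀA₁x + 2b₁ᵀx + c₁ ≤ 0 ⟹ xᵀA₂x + 2b₂ᵀx + c₂ ≤ 0`. Then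
there exists a `λ ≥ 0` such that `[A₂ b₂; b₂ᵀ c₂] ⪯ λ [A₁ b₁; b₁ᵀ c₁]`."

* **Lemma 4.2 as printed is FALSE** (`FawziEtAl2015_lemma42_false`): it omits the regularity
  hypothesis of its source [boyd2004convex, App. B.2 p. 655: "provided there exists a point `x₀` with
  `x₀ᵀF₁x₀ + 2g₁ᵀx₀ + h₁ < 0`"]; without it, `n = 1`, `q₁(x) = x²`, `q₂(x) = x` is a
  counterexample (`x² ≤ 0 ⟹ x ≤ 0` holds, but `[0 ½; ½ 0] ⪯ λ[1 0; 0 0]` for no `λ`). The corrected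
  statement, with Boyd–Vandenberghe's hypothesis, is the tree's `sProcedure_lossless`; it is
  re-exported here under the survey's name as `FawziEtAl2015_lemma42` (REFUTED-as-printed /
  corrected pattern of the tree, cf. `PrakashEtAl2017_thm6_false` / `thm6'`).
* **Constraint (2) ⟺ `P ⊆ E`** (`FawziEtAl2015_sec4_constraint2_iff`): for `A ⪰ 0` the sublevel
  set `E` is convex (`convex_quadSublevel`), so `conv{x_j} ⊆ E` iff every `x_j ∈ E`.
* **Constraint (3) ⟺ `E ⊆ Q`**, one half-plane `{gᵀx ≤ h}` at a time, for an `E` with an interior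
  point (the S-lemma's hypothesis; an ellipse containing a polygon has one): in the S-procedure's
  own orientation `∃ λ ≥ 0, λ[A b; bᵀ c] − [0 g/2; gᵀ/2 −h] ⪰ 0`
  (`quadSublevel_subset_halfspace_iff`, any dimension), and in the printed orientation
  `∃ λ ≥ 0, [A b; bᵀ c] ⪰ λ[0 g/2; gᵀ/2 −h]` for a genuine half-plane `g ≠ 0`
  (`FawziEtAl2015_sec4_constraint3_iff`; for `g = 0` the two orientations differ, see the docstring).
* **The full "if and only if" with (1)** (appended; `FawziEtAl2015_sec4_sdp_iff`): for `P = conv{x_j}`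
  with nonempty interior and a BOUNDED `Q = {g_iᵀy ≤ h_i}` (`g_i ≠ 0`, Lemma 4.1), a nondegenerate
  ellipse `E = {yᵀAy + 2bᵀy + c ≤ 0}`, `A ≻ 0`, with `P ⊆ E ⊆ Q` exists iff (1)–(3) is feasible
  (`A ⪰ 0`, `trace A = 1`, (2), (3) with multipliers `λ_i ≥ 0`); in (⇐) boundedness of `Q` is what
  upgrades `A ⪰ 0` to `A ≻ 0`, and the interior point of `P` is what forces every `λ_i > 0`.
-/

namespace Literature.Combinatorics.Optimization

open Matrix Literature.Analysis.Convex.ChebyshevChernoffBounds Literature.Analysis.Convex.SProcedure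

variable {m : Type*} [Fintype m]

/-! ### Lemma 4.2: false as printed; the corrected S-lemma -/

/-- **FGPRT Lemma 4.2 AS PRINTED is false**: without the strict-feasibility hypothesis of
[boyd2004convex, App. B.2], the implication `q₁ ≤ 0 ⟹ q₂ ≤ 0` does not yield a multiplier. The
counterexample `n = 1`, `A₁ = [1], b₁ = 0, c₁ = 0` (`q₁(x) = x²`), `A₂ = 0, b₂ = ½, c₂ = 0`
(`q₂(x) = x`): `x² ≤ 0` forces `x = 0`, so the implication holds; but
`λ[1 0; 0 0] − [0 ½; ½ 0]` has the value `λ − (λ + 1) = −1 < 0` at the vector `(1, λ + 1)`.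
[cite: FawziEtAl2015, Lemma 4.2 (p13); BoydVandenberghe2004, App. B.2 (p. 655)] -/
theorem FawziEtAl2015_lemma42_false :
    ¬ ∀ (n : ℕ) (A₁ A₂ : Matrix (Fin n) (Fin n) ℝ) (b₁ b₂ : Fin n → ℝ) (c₁ c₂ : ℝ),
      A₁.IsHermitian → A₂.IsHermitian →
      (∀ x, quadPQR A₁ b₁ c₁ x ≤ 0 → quadPQR A₂ b₂ c₂ x ≤ 0) →
      ∃ lam : ℝ, 0 ≤ lam ∧ (lam • quadBlock A₁ b₁ c₁ - quadBlock A₂ b₂ c₂).PosSemidef := by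
  intro h
  have himp : ∀ x : Fin 1 → ℝ, quadPQR (1 : Matrix (Fin 1) (Fin 1) ℝ) 0 0 x ≤ 0 →
      quadPQR (0 : Matrix (Fin 1) (Fin 1) ℝ) ![1 / 2] 0 x ≤ 0 := by
    intro x hx
    have h1 : quadPQR (1 : Matrix (Fin 1) (Fin 1) ℝ) 0 0 x = x 0 * x 0 := by
      simp [quadPQR, dotProduct]
    have h2 : quadPQR (0 : Matrix (Fin 1) (Fin 1) ℝ) ![1 / 2] 0 x = x 0 := by
      simp [quadPQR, dotProduct]
    rw [h1] at hx
    have hx0 : x 0 = 0 := by nlinarith [mul_self_nonneg (x 0)]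
    rw [h2, hx0]
  obtain ⟨lam, -, hpsd⟩ := h 1 1 0 0 ![1 / 2] 0 0 isHermitian_one isHermitian_zero himp
  rw [smul_quadBlock, quadBlock_sub] at hpsd
  have hq := hpsd.dotProduct_mulVec_nonneg (Sum.elim ![1] fun _ => lam + 1)
  rw [star_trivial, dotProduct_quadBlock_mulVec] at hq
  simp [dotProduct, Matrix.smul_mulVec, Matrix.one_mulVec] at hq
  norm_num at hq
  linarith

/-- **FGPRT Lemma 4.2, corrected** (= the S-lemma / S-procedure of [boyd2004convex, App. B.2] WITH
its hypothesis "provided there exists a point `x₀` with `x₀ᵀA₁x₀ + 2b₁ᵀx₀ + c₁ < 0`"): if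
`q₁(x) ≤ 0 ⟹ q₂(x) ≤ 0` for all `x` and `q₁(x₀) < 0` for some `x₀`, then
`[A₂ b₂; b₂ᵀ c₂] ⪯ λ[A₁ b₁; b₁ᵀ c₁]` for some `λ ≥ 0`. This is the tree's `sProcedure_lossless`
(Boyd–Vandenberghe App. B), re-exported under the survey's name.
[cite: FawziEtAl2015, Lemma 4.2 (p13); BoydVandenberghe2004, App. B.2 (p. 655)] -/
theorem FawziEtAl2015_lemma42 [DecidableEq m] {A₁ A₂ : Matrix m m ℝ} (hA₁ : A₁.IsHermitian)
    (hA₂ : A₂.IsHermitian) {b₁ b₂ : m → ℝ} {c₁ c₂ : ℝ} (hS : ∃ x₀, quadPQR A₁ b₁ c₁ x₀ < 0)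
    (himp : ∀ x, quadPQR A₁ b₁ c₁ x ≤ 0 → quadPQR A₂ b₂ c₂ x ≤ 0) :
    ∃ lam : ℝ, 0 ≤ lam ∧ (lam • quadBlock A₁ b₁ c₁ - quadBlock A₂ b₂ c₂).PosSemidef :=
  sProcedure_lossless hA₁ hA₂ hS himp

/-! ### Constraint (2): `P ⊆ E` -/

/-- The convexity identity of a quadratic with symmetric `A`:
`(1−t) q(x) + t q(y) − q((1−t)x + ty) = t(1−t)·(x−y)ᵀA(x−y)`. [cite: FawziEtAl2015, §4 (p13), constraint (2)] -/
theorem quadPQR_convex_combo {A : Matrix m m ℝ} (hA : A.IsHermitian) (b : m → ℝ) (c : ℝ)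
    (x y : m → ℝ) (t : ℝ) :
    (1 - t) * quadPQR A b c x + t * quadPQR A b c y - quadPQR A b c ((1 - t) • x + t • y) =
      t * (1 - t) * ((x - y) ⬝ᵥ A *ᵥ (x - y)) := by
  have hsymm : y ⬝ᵥ A *ᵥ x = x ⬝ᵥ A *ᵥ y := by
    have hT : Aᵀ = A := by
      have := hA.eq
      rwa [conjTranspose_eq_transpose_of_trivial] at this
    rw [dotProduct_mulVec y A x, ← mulVec_transpose, hT, dotProduct_comm]
  simp only [quadPQR, mulVec_add, mulVec_smul, mulVec_sub, dotProduct_add, dotProduct_sub,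
    dotProduct_smul, add_dotProduct, sub_dotProduct, smul_dotProduct, smul_eq_mul, hsymm]
  ring

/-- For `A ⪰ 0` the sublevel set `E = {x : xᵀAx + 2bᵀx + c ≤ 0}` is convex.
[cite: FawziEtAl2015, §4 (p13), constraint (2)] -/
theorem convex_quadSublevel {A : Matrix m m ℝ} (hA : A.PosSemidef) (b : m → ℝ) (c : ℝ) :
    Convex ℝ {x : m → ℝ | quadPQR A b c x ≤ 0} := by
  intro x hx y hy s t hs ht hst
  simp only [Set.mem_setOf_eq] at hx hy ⊢
  have hs' : s = 1 - t := by linarith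
  subst hs'
  have key := quadPQR_convex_combo hA.1 b c x y t
  have hq : 0 ≤ (x - y) ⬝ᵥ A *ᵥ (x - y) := by
    have := hA.dotProduct_mulVec_nonneg (x - y)
    rwa [star_trivial] at this
  have h3 : 0 ≤ t * (1 - t) * ((x - y) ⬝ᵥ A *ᵥ (x - y)) := by positivity
  nlinarith [mul_nonneg hs (neg_nonneg.mpr hx), mul_nonneg ht (neg_nonneg.mpr hy), key, h3]

/-- **Constraint (2) ⟺ `P ⊆ E`**: for `A ⪰ 0`, `conv{x_1,…,x_v} ⊆ E` iff
`[x_j;1]ᵀ[A b; bᵀ c][x_j;1] ≤ 0` for every `j`. [cite: FawziEtAl2015, §4 (p13), constraint (2)] -/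
theorem FawziEtAl2015_sec4_constraint2_iff {ι : Type*} {A : Matrix m m ℝ} (hA : A.PosSemidef)
    (b : m → ℝ) (c : ℝ) (x : ι → m → ℝ) :
    convexHull ℝ (Set.range x) ⊆ {y | quadPQR A b c y ≤ 0} ↔ ∀ j, quadPQR A b c (x j) ≤ 0 := by
  rw [(convex_quadSublevel hA b c).convexHull_subset_iff, Set.range_subset_iff]
  rfl

/-! ### Constraint (3): `E ⊆ Q`, one half-plane at a time -/

/-- **`E ⊆ {x : gᵀx ≤ h}` iff an S-procedure certificate exists** (any dimension): for symmetric
`A` and an `E = {x : xᵀAx + 2bᵀx + c ≤ 0}` with a point where the quadratic is negative,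
`E ⊆ {gᵀx ≤ h} ⟺ ∃ λ ≥ 0, λ[A b; bᵀ c] − [0 g/2; gᵀ/2 −h] ⪰ 0` — the S-lemma (corrected
Lemma 4.2) with `q₂(x) = gᵀx − h = [x;1]ᵀ[0 g/2; gᵀ/2 −h][x;1]`.
[cite: FawziEtAl2015, §4 (p13), constraint (3); BoydVandenberghe2004, App. B.2 (p. 655)] -/
theorem quadSublevel_subset_halfspace_iff [DecidableEq m] {A : Matrix m m ℝ} (hA : A.IsHermitian)
    {b : m → ℝ} {c : ℝ} (hS : ∃ x₀, quadPQR A b c x₀ < 0) (g : m → ℝ) (h : ℝ) :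
    {x | quadPQR A b c x ≤ 0} ⊆ {x | g ⬝ᵥ x ≤ h} ↔
      ∃ lam : ℝ, 0 ≤ lam ∧
        (lam • quadBlock A b c - quadBlock 0 ((1 / 2 : ℝ) • g) (-h)).PosSemidef := by
  have hset : {x : m → ℝ | g ⬝ᵥ x ≤ h} = {x | quadPQR 0 ((1 / 2 : ℝ) • g) (-h) x ≤ 0} := by
    ext x
    simp only [Set.mem_setOf_eq, quadPQR_halfspace, sub_nonpos]
  rw [hset]
  exact ellipsoid_subset_iff hA isHermitian_zero hS

/-- The quadratic of `[A b; bᵀ c] − λ[0 g/2; gᵀ/2 −h]` is `q(x) − λ(gᵀx − h)`.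
[cite: FawziEtAl2015, §4 (p13), constraint (3)] -/
theorem quadPQR_sub_smul_halfspace (A : Matrix m m ℝ) (b : m → ℝ) (c : ℝ) (g : m → ℝ)
    (h lam : ℝ) (z : m → ℝ) :
    quadPQR (A - lam • (0 : Matrix m m ℝ)) (b - lam • ((1 / 2 : ℝ) • g)) (c - lam * (-h)) z =
      quadPQR A b c z - lam * (g ⬝ᵥ z - h) := by
  simp only [quadPQR, smul_zero, sub_zero, sub_dotProduct, smul_dotProduct, smul_eq_mul]
  ring

/-- **Constraint (3) ⟺ `E ⊆ Q`, in the printed orientation**: for a genuine half-plane (`g ≠ 0`)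
and an `E` with a point where its quadratic is negative,
`E ⊆ {gᵀx ≤ h} ⟺ ∃ λ ≥ 0, [A b; bᵀ c] ⪰ λ[0 g/2; gᵀ/2 −h]`. (`⇒`: the S-procedure multiplier
`λ'` of `quadSublevel_subset_halfspace_iff` is nonzero because `−[0 g/2; gᵀ/2 −h] ⪰ 0` would make
`gᵀx ≤ h` for all `x`, impossible for `g ≠ 0`; take `λ = 1/λ'`. `⇐`: `λ(gᵀx − h) ≤ q(x) ≤ 0` on
`E`, and `λ = 0` would make `q ≥ 0` everywhere. For `g = 0` the printed orientation can fail while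
the containment holds, e.g. `h ≥ 0` and `[A b; bᵀ c]` not `⪰ 0`.)
[cite: FawziEtAl2015, §4 (p13), constraint (3)] -/
theorem FawziEtAl2015_sec4_constraint3_iff [DecidableEq m] {A : Matrix m m ℝ} (hA : A.IsHermitian)
    {b : m → ℝ} {c : ℝ} (hS : ∃ x₀, quadPQR A b c x₀ < 0) {g : m → ℝ} (hg : g ≠ 0) (h : ℝ) :
    {x | quadPQR A b c x ≤ 0} ⊆ {x | g ⬝ᵥ x ≤ h} ↔
      ∃ lam : ℝ, 0 ≤ lam ∧
        (quadBlock A b c - lam • quadBlock 0 ((1 / 2 : ℝ) • g) (-h)).PosSemidef := by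
  have hgg : 0 < g ⬝ᵥ g := by
    refine lt_of_le_of_ne ?_ (fun h0 => hg (dotProduct_self_eq_zero.mp h0.symm))
    unfold dotProduct
    exact Finset.sum_nonneg fun i _ => mul_self_nonneg _
  constructor
  · intro hsub
    obtain ⟨lam, hlam, hpsd⟩ := (quadSublevel_subset_halfspace_iff hA hS g h).mp hsub
    have hlam0 : lam ≠ 0 := by
      rintro rfl
      rw [zero_smul, zero_sub, ← neg_one_smul ℝ, smul_quadBlock] at hpsd
      have hq := quadPQR_nonneg_of_posSemidef hpsd (((h + 1) / (g ⬝ᵥ g)) • g)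
      simp only [quadPQR, smul_zero, zero_mulVec, dotProduct_zero, zero_add, smul_dotProduct,
        dotProduct_smul, smul_eq_mul] at hq
      have hc : (h + 1) / (g ⬝ᵥ g) * (g ⬝ᵥ g) = h + 1 := div_mul_cancel₀ _ hgg.ne'
      nlinarith [hc, hq]
    have hlampos : 0 < lam := lt_of_le_of_ne hlam (Ne.symm hlam0)
    refine ⟨1 / lam, by positivity, ?_⟩
    have heq : quadBlock A b c - (1 / lam) • quadBlock 0 ((1 / 2 : ℝ) • g) (-h) =
        (1 / lam) • (lam • quadBlock A b c - quadBlock 0 ((1 / 2 : ℝ) • g) (-h)) := by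
      rw [smul_sub, smul_smul, one_div_mul_cancel hlam0, one_smul]
    rw [heq]
    exact hpsd.smul (by positivity)
  · rintro ⟨lam, hlam, hpsd⟩ z hz
    simp only [Set.mem_setOf_eq] at hz ⊢
    rw [smul_quadBlock, quadBlock_sub] at hpsd
    have hform : ∀ w, lam * (g ⬝ᵥ w - h) ≤ quadPQR A b c w := fun w => by
      have h0 := quadPQR_nonneg_of_posSemidef hpsd w
      rw [quadPQR_sub_smul_halfspace] at h0
      linarith
    have hlam0 : lam ≠ 0 := by
      rintro rfl
      obtain ⟨x₀, hx₀⟩ := hS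
      have := hform x₀
      linarith
    have hlampos : 0 < lam := lt_of_le_of_ne hlam (Ne.symm hlam0)
    have h1 : lam * (g ⬝ᵥ z - h) ≤ 0 := (hform z).trans hz
    have h2 : g ⬝ᵥ z - h ≤ 0 := by
      by_contra hcon
      push Not at hcon
      have := mul_pos hlampos hcon
      linarith
    linarith


/-! ### The full equivalence: a sandwiched (nondegenerate) ellipse exists iff (1)–(3) is feasible
(appended) -/

section SdpIff

/-- Expansion of a quadratic along a line: `q(y + tv) = q(y) + 2t·(Ay + b)ᵀv + t²·vᵀAv` for symmetric
`A`. [folklore] -/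
private theorem quadPQR_add_smul {A : Matrix m m ℝ} (hA : A.IsHermitian) (b : m → ℝ) (c : ℝ)
    (y v : m → ℝ) (t : ℝ) :
    quadPQR A b c (y + t • v) =
      quadPQR A b c y + 2 * t * ((A *ᵥ y + b) ⬝ᵥ v) + t ^ 2 * (v ⬝ᵥ A *ᵥ v) := by
  have hsymm : v ⬝ᵥ A *ᵥ y = y ⬝ᵥ A *ᵥ v := by
    have hAT : Aᵀ = A := by
      have h := hA
      rw [Matrix.IsHermitian, conjTranspose_eq_transpose_of_trivial] at h
      exact h
    rw [dotProduct_mulVec, ← mulVec_transpose, hAT, dotProduct_comm]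
  simp only [quadPQR, mulVec_add, mulVec_smul, dotProduct_add, dotProduct_smul, add_dotProduct,
    smul_dotProduct, smul_eq_mul, hsymm]
  rw [dotProduct_comm (A *ᵥ y) v, hsymm, dotProduct_comm b v, dotProduct_comm v b]
  ring

/-- Scaling `(A,b,c)` by `s` scales the quadratic by `s`. [folklore] -/
private theorem quadPQR_scale (A : Matrix m m ℝ) (b : m → ℝ) (c s : ℝ) (y : m → ℝ) :
    quadPQR (s • A) (s • b) (s * c) y = s * quadPQR A b c y := by
  simp only [quadPQR, Matrix.smul_mulVec, dotProduct_smul, smul_dotProduct, smul_eq_mul]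
  ring

/-- If `A ⪰ 0` has a direction of positive curvature (`vᵀAv > 0` for some `v`), then at an INTERIOR
point `y₀` of the sublevel set `E = {q ≤ 0}` the quadratic is strictly negative: otherwise
`q(y₀) = 0` and `q(y₀ ± tv) ≤ 0` for small `t` force `t²·vᵀAv ≤ 0`. [folklore] -/
private theorem quadPQR_neg_of_mem_interior {A : Matrix m m ℝ} (hA : A.IsHermitian) {b : m → ℝ}
    {c : ℝ} {v : m → ℝ} (hv : 0 < v ⬝ᵥ A *ᵥ v) {y₀ : m → ℝ}
    (hy : y₀ ∈ interior {y | quadPQR A b c y ≤ 0}) : quadPQR A b c y₀ < 0 := by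
  have hy0 : y₀ ∈ {y | quadPQR A b c y ≤ 0} := interior_subset hy
  rw [Set.mem_setOf_eq] at hy0
  by_contra hge
  push Not at hge
  have hq0 : quadPQR A b c y₀ = 0 := le_antisymm hy0 hge
  obtain ⟨ε, hε, hball⟩ := Metric.mem_nhds_iff.mp (mem_interior_iff_mem_nhds.mp hy)
  -- a small step `t` with `‖t v‖ < ε`
  set t : ℝ := ε / (2 * (‖v‖ + 1)) with ht
  have hvn : 0 < ‖v‖ + 1 := by positivity
  have htpos : 0 < t := by rw [ht]; positivity
  have hstep : ∀ s : ℝ, |s| = t → y₀ + s • v ∈ {y | quadPQR A b c y ≤ 0} := fun s hs => by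
    refine hball ?_
    rw [Metric.mem_ball, dist_eq_norm, add_sub_cancel_left, norm_smul, Real.norm_eq_abs, hs]
    calc t * ‖v‖ ≤ t * (‖v‖ + 1) := by nlinarith [norm_nonneg v]
      _ = ε / 2 := by rw [ht]; field_simp
      _ < ε := by linarith
  have h1 : quadPQR A b c (y₀ + t • v) ≤ 0 := hstep t (abs_of_pos htpos)
  have h2 : quadPQR A b c (y₀ + (-t) • v) ≤ 0 := hstep (-t) (by rw [abs_neg, abs_of_pos htpos])
  rw [quadPQR_add_smul hA, hq0] at h1 h2
  have h3 : t ^ 2 * (v ⬝ᵥ A *ᵥ v) ≤ 0 := by nlinarith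
  have h4 : 0 < t ^ 2 * (v ⬝ᵥ A *ᵥ v) := by positivity
  linarith

/-- A psd matrix of trace `1` has a direction of positive curvature (some diagonal entry is positive).
[folklore] -/
private theorem exists_dotProduct_mulVec_pos_of_trace_eq_one [DecidableEq m] {A : Matrix m m ℝ}
    (htr : A.trace = 1) :
    ∃ v : m → ℝ, 0 < v ⬝ᵥ A *ᵥ v := by
  classical
  by_contra hneg
  push Not at hneg
  have hdiag : ∀ i, A i i ≤ 0 := fun i => by
    have h := hneg (Pi.single i 1)
    rwa [mulVec_single_one, single_one_dotProduct] at h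
  have hsum : A.trace ≤ 0 := Finset.sum_nonpos fun i _ => hdiag i
  linarith

/-- **FGPRT §4, the SDP characterisation in full** (p13, verbatim: "One can show that there exists an
ellipse sandwiched between `P` and `Q` if, and only if, there exist `A ∈ S², b ∈ ℝ²` and `c ∈ ℝ` such
that: 1. `A ⪰ 0`, `trace(A) = 1`; 2. `[x_j;1]ᵀ[A b; bᵀ c][x_j;1] ≤ 0 ∀ j = 1,…,v`; 3. `∃ λ_i ≥ 0 :
[A b; bᵀ c] ⪰ λ_i [0 g_iᵀ/2; g_i/2 −h_i] ∀ i = 1,…,f`"). Typed for `P = conv{x_j}` with nonempty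
interior (which holds when `rank M = 3`, the vertices then spanning the plane affinely) and
`Q = {y : g_iᵀy ≤ h_i ∀ i}` BOUNDED (Lemma 4.1) with genuine half-planes `g_i ≠ 0`, and "ellipse"
= nondegenerate sublevel set `E = {y : yᵀAy + 2bᵀy + c ≤ 0}` with `A ≻ 0` (the currency of
`FawziEtAl2015_sec4_ellipse_holds`); stated in any dimension `m` (the text: `m = 2`). PROOF. (⇒):
divide `(A,b,c)` by `trace A > 0` (same `E`); (2) is `x_j ∈ P ⊆ E`; an interior point `y₀` of `P`
is interior to `E`, where `q(y₀) < 0` (`quadPQR_neg_of_mem_interior`), so the corrected S-lemma applies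
facet by facet (`FawziEtAl2015_sec4_constraint3_iff`). (⇐): `P ⊆ E` by (2) and convexity; `q(y₀) < 0` at
an interior point of `P` because `trace A = 1` gives a direction of positive curvature; hence every
`λ_i > 0` and (3) yields `E ⊆ Q` pointwise; finally `A ≻ 0`, for a kernel direction `u` of the form
`uᵀAu = 0` would give a half-line `y₀ ± tu` inside `E ⊆ Q`, contradicting boundedness of `Q`.
[cite: FawziEtAl2015, §4 (p13), "(1)–(3)"; BoydVandenberghe2004, App. B.2 (p. 655)] -/
theorem FawziEtAl2015_sec4_sdp_iff [DecidableEq m] [Nonempty m] {ι φ : Type*} (x : ι → m → ℝ) (g : φ → m → ℝ)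
    (h : φ → ℝ) (hg : ∀ i, g i ≠ 0) (hQ : Bornology.IsBounded {y : m → ℝ | ∀ i, g i ⬝ᵥ y ≤ h i})
    (hP : (interior (convexHull ℝ (Set.range x))).Nonempty) :
    (∃ (A : Matrix m m ℝ) (b : m → ℝ) (c : ℝ), A.PosDef ∧
        convexHull ℝ (Set.range x) ⊆ {y | quadPQR A b c y ≤ 0} ∧
        {y | quadPQR A b c y ≤ 0} ⊆ {y | ∀ i, g i ⬝ᵥ y ≤ h i}) ↔
      ∃ (A : Matrix m m ℝ) (b : m → ℝ) (c : ℝ) (lam : φ → ℝ), A.PosSemidef ∧ A.trace = 1 ∧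
        (∀ j, quadPQR A b c (x j) ≤ 0) ∧
        ∀ i, 0 ≤ lam i ∧
          (quadBlock A b c - lam i • quadBlock 0 ((1 / 2 : ℝ) • g i) (-h i)).PosSemidef := by
  classical
  obtain ⟨y₀, hy₀⟩ := hP
  constructor
  · rintro ⟨A, b, c, hA, hPE, hEQ⟩
    -- normalise the trace
    have htr : 0 < A.trace := hA.trace_pos
    set s : ℝ := A.trace⁻¹ with hs
    have hspos : 0 < s := inv_pos.mpr htr
    have hA' : (s • A).PosSemidef := hA.posSemidef.smul hspos.le
    have hE : {y | quadPQR (s • A) (s • b) (s * c) y ≤ 0} = {y | quadPQR A b c y ≤ 0} := by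
      ext y
      simp only [Set.mem_setOf_eq, quadPQR_scale]
      constructor
      · intro hy
        by_contra hcon
        push Not at hcon
        have := mul_pos hspos hcon
        linarith
      · intro hy
        exact mul_nonpos_of_nonneg_of_nonpos hspos.le hy
    -- a strictly feasible point: the interior point `y₀` of `P ⊆ E`
    have hv : ∃ v : m → ℝ, 0 < v ⬝ᵥ (s • A) *ᵥ v := by
      refine ⟨Pi.single (Classical.arbitrary m) 1, ?_⟩
      have h1 := hA.dotProduct_mulVec_pos (x := Pi.single (Classical.arbitrary m) (1 : ℝ))
        (by simp)
      rw [star_trivial] at h1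
      rw [Matrix.smul_mulVec, dotProduct_smul, smul_eq_mul]
      exact mul_pos hspos h1
    obtain ⟨v, hv⟩ := hv
    have hy₀E : y₀ ∈ interior {y | quadPQR (s • A) (s • b) (s * c) y ≤ 0} := by
      rw [hE]
      exact interior_mono hPE hy₀
    have hS : ∃ x₀, quadPQR (s • A) (s • b) (s * c) x₀ < 0 :=
      ⟨y₀, quadPQR_neg_of_mem_interior hA'.1 hv hy₀E⟩
    -- the multipliers, facet by facet
    have hlam : ∀ i, ∃ lam : ℝ, 0 ≤ lam ∧
        (quadBlock (s • A) (s • b) (s * c) - lam • quadBlock 0 ((1 / 2 : ℝ) • g i) (-h i)).PosSemidef :=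
      fun i => (FawziEtAl2015_sec4_constraint3_iff hA'.1 hS (hg i) (h i)).mp (by
        rw [hE]
        exact fun y hy => (hEQ hy) i)
    choose lam hlam0 hlam using hlam
    refine ⟨s • A, s • b, s * c, lam, hA', ?_, fun j => ?_, fun i => ⟨hlam0 i, hlam i⟩⟩
    · rw [trace_smul, smul_eq_mul, hs, inv_mul_cancel₀ htr.ne']
    · have hj : x j ∈ {y | quadPQR (s • A) (s • b) (s * c) y ≤ 0} := by
        rw [hE]
        exact hPE (subset_convexHull ℝ _ ⟨j, rfl⟩)
      exact hj
  · rintro ⟨A, b, c, lam, hA, htr, h2, h3⟩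
    have hPE : convexHull ℝ (Set.range x) ⊆ {y | quadPQR A b c y ≤ 0} :=
      (FawziEtAl2015_sec4_constraint2_iff hA b c x).mpr h2
    obtain ⟨v, hv⟩ := exists_dotProduct_mulVec_pos_of_trace_eq_one htr
    have hq0 : quadPQR A b c y₀ < 0 := quadPQR_neg_of_mem_interior hA.1 hv (interior_mono hPE hy₀)
    -- (3) pointwise: `λ_i (g_iᵀy − h_i) ≤ q(y)`, and `λ_i > 0`
    have hform : ∀ i y, lam i * (g i ⬝ᵥ y - h i) ≤ quadPQR A b c y := fun i y => by
      have hpsd := (h3 i).2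
      rw [smul_quadBlock, quadBlock_sub] at hpsd
      have h0 := quadPQR_nonneg_of_posSemidef hpsd y
      rw [quadPQR_sub_smul_halfspace] at h0
      linarith
    have hlampos : ∀ i, 0 < lam i := fun i => by
      rcases (h3 i).1.eq_or_lt with h0 | h0
      · have := hform i y₀
        rw [← h0, zero_mul] at this
        linarith
      · exact h0
    have hEQ : {y | quadPQR A b c y ≤ 0} ⊆ {y | ∀ i, g i ⬝ᵥ y ≤ h i} := fun y hy i => by
      have h1 : lam i * (g i ⬝ᵥ y - h i) ≤ 0 := (hform i y).trans hy
      by_contra hcon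
      push Not at hcon
      have := mul_pos (hlampos i) (sub_pos.mpr hcon)
      linarith
    -- `A ≻ 0`: a direction `u ≠ 0` with `uᵀAu = 0` would put a half-line inside the bounded `E`
    refine ⟨A, b, c, ?_, hPE, hEQ⟩
    refine Matrix.PosDef.of_dotProduct_mulVec_pos hA.1 fun u hu => ?_
    rw [star_trivial]
    have hu0 : 0 ≤ u ⬝ᵥ A *ᵥ u := by
      have := hA.dotProduct_mulVec_nonneg u
      rwa [star_trivial] at this
    rcases hu0.eq_or_lt with hzero | hpos
    · exfalso
      obtain ⟨R, hR⟩ := (hQ.subset hEQ).exists_norm_le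
      -- choose the sign `σ` with `σ · (Ay₀ + b)ᵀu ≤ 0`
      set w : ℝ := (A *ᵥ y₀ + b) ⬝ᵥ u with hw
      obtain ⟨σ, hσ1, hσw⟩ : ∃ σ : ℝ, |σ| = 1 ∧ σ * w ≤ 0 := by
        rcases le_or_gt 0 w with hw0 | hw0
        · exact ⟨-1, by simp, by linarith⟩
        · exact ⟨1, by simp, by linarith⟩
      -- the half-line `y₀ + (σ t) u`, `t ≥ 0`, lies in `E`
      have hline : ∀ t : ℝ, 0 ≤ t → quadPQR A b c (y₀ + (σ * t) • u) ≤ 0 := fun t ht => by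
        rw [quadPQR_add_smul hA.1, ← hzero, mul_zero, add_zero, ← hw]
        nlinarith [mul_nonneg ht (neg_nonneg.mpr hσw)]
      have hupos : 0 < ‖u‖ := norm_pos_iff.mpr hu
      set t : ℝ := (R + ‖y₀‖ + 1) / ‖u‖ with ht
      have htnn : 0 ≤ t := by
        rw [ht]
        have : 0 ≤ R := (norm_nonneg _).trans (hR y₀ (le_of_lt hq0))
        positivity
      have hmem := hR _ (hline t htnn)
      have hnorm : ‖(σ * t) • u‖ = R + ‖y₀‖ + 1 := by
        rw [norm_smul, Real.norm_eq_abs, abs_mul, hσ1, one_mul, abs_of_nonneg htnn, ht,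
          div_mul_cancel₀ _ hupos.ne']
      have htri : ‖(σ * t) • u‖ ≤ ‖y₀ + (σ * t) • u‖ + ‖y₀‖ := by
        have := norm_sub_le (y₀ + (σ * t) • u) y₀
        rwa [add_sub_cancel_left] at this
      linarith
    · exact hpos

end SdpIff

end Literature.Combinatorics.Optimization
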